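import Summits.QuantumFields.YangMills.Theorems.VirialFluxGapRingGaugeAction
import Summits.QuantumFields.YangMills.Theorems.LuscherReductionRunningReductionAxialGauge
import HarnessLib

/-!
# Tree gauge on slice 0 of a ring history: the ring integral of a gauge-invariant functional, exactly, on the reduced space
# (layer (B2), step 0, of the DIRECT Laplace road to ⟨stmt-QuantumFields-24204⟩ `VirialFluxGap.SharpTwistedLaplace`)

Helper module (free-hands work of width seat ym-line-sfw-p2-w2 g49, cell ym-idea-1).  The gauge group `𝒢 = SU(2)^{sites}`
(`dim = 3L³`) acting on `2L`-slice ring histories `(U⃗, g)` is reduced EXACTLY to the residual constant `SU(2)` by the comb∕tree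
gauge of ✓`LuscherReductionRunningReduction{TreeGauge,TreeGaugeHaar,AxialGauge}` applied to slice `0`:
* `measurable_ringCons`, `measurePreserving_ringSplit` — splitting off slice `0`: `(U⃗, g) ↦ (U_0, ((U_{j+1})_j, g))` carries
  `ringMeasure` to `configMeasure ⊗ ((⊗_{j<2L−1} configMeasure) ⊗ gaugeMeasure)`;
* ★ `lintegral_ringMeasure_eq_treeGauge` — for every measurable GAUGE-INVARIANT `G ≥ 0` (values in `ℝ≥0∞`):
  `∫ G d(ringMeasure) = ∫_{w ∈ SU(2)^{off-tree}} ∫_{r = ((U_j)_{j≥1}, g)} G(glue w ∷ r) dr dw`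
  (tree: `measurePreserving_recon` puts slice `0` in the coordinates `(t, w)`, `recon(t,w) = γ⁻¹·glue w` with `γ = treeGauge`; gauge
  invariance moves `γ` onto the other slices and the seam, where product Haar is invariant (`Elitzur.measurePreserving_gaugeTransform`,
  conjugation invariance of Haar); the tree links `t` then integrate to `1`);
* ★ `integral_ringMeasure_eq_treeGauge` — the same for real `0 ≤ G ≤ C`;
* the residual symmetry — a CONSTANT gauge transformation `k` maps `glue w` to `glue(k w k⁻¹)` — is ✓`glue_conj'` of
  `…LuscherReductionRunningReductionAxialConj` (not restated here).
USE (memo `DIRECT-LAPLACE-24204-v4.md` §8): on the reduced space `SU(2)^{off} × (slices 1…2L−1) × (seam)` the only symmetry left is the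
3-dimensional constant `SU(2)` (stabiliser `{±1}`), whose orbit map has an `O(1)` (not `1/poly(L)`) transversality constant — this removes the
lattice-Poincaré input from the explicit-radius slice chart.  Everything here is PROVED; no definitions, no named facts.
HONEST FRAMING: measure-theoretic bookkeeping; ⟨24204⟩, ⟨24319⟩ and every rung stay OPEN; the Yang–Mills mass gap (Clay) is NOT touched;
no summit is proved by a line.
-/

noncomputable section

open MeasureTheory Filter Set Function
open scoped BigOperators Topology ENNReal
open Literature.MathematicalPhysics.QuantumFieldTheory hiding SU2
open Literature.MathematicalPhysics.QuantumLattice (measurePreserving_mul_mul_inv_haarProbability)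
open Summit.QuantumFields.YangMills.Theorems.FemtoTransferGap
open Summit.QuantumFields.YangMills.Theorems.FemtoTransferGap.TT

namespace Summit.QuantumFields.YangMills.Theorems.VirialFluxGap.RingDeficit

variable {L : ℕ} [NeZero L]

/-! ## §1 Splitting off slice `0` -/

omit [NeZero L] in
/-- Re-assembling a ring history from slice `0` and the rest is measurable. [folklore] -/
theorem measurable_ringCons :
    Measurable (fun p : GaugeConfig 3 L SU2 × ((Fin (2 * L - 1) → GaugeConfig 3 L SU2) × (Site 3 L → SU2)) =>
      ((Fin.cons p.1 p.2.1 : Fin (2 * L - 1 + 1) → GaugeConfig 3 L SU2), p.2.2)) := by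
  refine Measurable.prodMk (measurable_pi_lambda _ fun i => ?_) (measurable_snd.comp measurable_snd)
  refine Fin.cases ?_ (fun j => ?_) i
  · simp only [Fin.cons_zero]; exact measurable_fst
  · simp only [Fin.cons_succ]; exact (measurable_pi_apply j).comp (measurable_fst.comp measurable_snd)

/-- **Splitting off slice `0` preserves measure**: `(U⃗, g) ↦ (U_0, ((U_{j+1})_j, g))` carries `ringMeasure L` to
`configMeasure ⊗ ((⊗_j configMeasure) ⊗ gaugeMeasure)` (Mathlib `measurePreserving_piFinSuccAbove`). [folklore] -/
theorem measurePreserving_ringSplit :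
    MeasurePreserving (fun p : (Fin (2 * L - 1 + 1) → GaugeConfig 3 L SU2) × (Site 3 L → SU2) =>
        (p.1 0, ((fun j : Fin (2 * L - 1) => p.1 j.succ), p.2)))
      (ringMeasure L)
      ((configMeasure SU2 L).prod
        ((Measure.pi fun _ : Fin (2 * L - 1) => configMeasure SU2 L).prod (gaugeMeasure L))) := by
  haveI : IsProbabilityMeasure (gaugeMeasure L) := by unfold gaugeMeasure; infer_instance
  have h1 : MeasurePreserving
      (fun U : Fin (2 * L - 1 + 1) → GaugeConfig 3 L SU2 => (U 0, fun j : Fin (2 * L - 1) => U j.succ))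
      (Measure.pi fun _ : Fin (2 * L - 1 + 1) => configMeasure SU2 L)
      ((configMeasure SU2 L).prod (Measure.pi fun _ : Fin (2 * L - 1) => configMeasure SU2 L)) := by
    convert measurePreserving_piFinSuccAbove (fun _ : Fin (2 * L - 1 + 1) => configMeasure SU2 L) 0 using 1
    funext U
    simp
    rfl
  have h2 := (measurePreserving_prodAssoc (configMeasure SU2 L)
    (Measure.pi fun _ : Fin (2 * L - 1) => configMeasure SU2 L) (gaugeMeasure L)).comp
    (h1.prod (MeasurePreserving.id (gaugeMeasure L)))
  unfold ringMeasure
  convert h2 using 1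
  funext p
  rfl

/-! ## §2 The ring integral in the tree gauge of slice `0` -/

/-- ★ **The ring integral of a gauge-invariant functional in tree gauge** (`ℝ≥0∞`-valued): for measurable `G` with
`G(h·p) = G(p)` for all gauge transformations `h`,
`∫ G d(ringMeasure L) = ∫_{w} ∫_{r} G(glue w ∷ r) d((⊗_j configMeasure) ⊗ gaugeMeasure)(r) dHaar^{off}(w)`. [cite: SeilerLNP1982, §2] -/
theorem lintegral_ringMeasure_eq_treeGauge
    {G : (Fin (2 * L - 1 + 1) → GaugeConfig 3 L SU2) × (Site 3 L → SU2) → ℝ≥0∞} (hG : Measurable G)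
    (hinv : ∀ (h : Site 3 L → SU2) (p : (Fin (2 * L - 1 + 1) → GaugeConfig 3 L SU2) × (Site 3 L → SU2)),
      G ((fun i => gaugeTransform h (p.1 i)), h * p.2 * h⁻¹) = G p) :
    ∫⁻ p, G p ∂(ringMeasure L) =
      ∫⁻ w, ∫⁻ r, G ((Fin.cons (glue w) r.1 : Fin (2 * L - 1 + 1) → GaugeConfig 3 L SU2), r.2)
        ∂((Measure.pi fun _ : Fin (2 * L - 1) => configMeasure SU2 L).prod (gaugeMeasure L))
        ∂(Measure.pi fun _ : OffIdx L => haarProbability SU2) := by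
  haveI : IsProbabilityMeasure (gaugeMeasure L) := by unfold gaugeMeasure; infer_instance
  set ρ : Measure ((Fin (2 * L - 1) → GaugeConfig 3 L SU2) × (Site 3 L → SU2)) :=
    (Measure.pi fun _ : Fin (2 * L - 1) => configMeasure SU2 L).prod (gaugeMeasure L) with hρ
  set τ : Measure (TreeIdx L → SU2) := Measure.pi fun _ : TreeIdx L => haarProbability SU2 with hτ
  set ω : Measure (OffIdx L → SU2) := Measure.pi fun _ : OffIdx L => haarProbability SU2 with hω
  have hA := measurable_ringCons (L := L)
  -- step 1: split off slice 0
  have h1 : ∫⁻ p, G p ∂(ringMeasure L) =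
      ∫⁻ q, G ((Fin.cons q.1 q.2.1 : Fin (2 * L - 1 + 1) → GaugeConfig 3 L SU2), q.2.2)
        ∂((configMeasure SU2 L).prod ρ) := by
    have e : ∀ p : (Fin (2 * L - 1 + 1) → GaugeConfig 3 L SU2) × (Site 3 L → SU2),
        G p = (fun q : GaugeConfig 3 L SU2 × ((Fin (2 * L - 1) → GaugeConfig 3 L SU2) × (Site 3 L → SU2)) =>
          G ((Fin.cons q.1 q.2.1 : Fin (2 * L - 1 + 1) → GaugeConfig 3 L SU2), q.2.2))
          (p.1 0, ((fun j : Fin (2 * L - 1) => p.1 j.succ), p.2)) := by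
      intro p
      show G p = G (Fin.cons (p.1 0) (Fin.tail p.1), p.2)
      rw [Fin.cons_self_tail]
    rw [lintegral_congr e]
    exact measurePreserving_ringSplit.lintegral_comp (hG.comp hA)
  -- step 2: slice 0 in comb-gauge coordinates `(t, w)`
  have h2 : ∫⁻ q, G ((Fin.cons q.1 q.2.1 : Fin (2 * L - 1 + 1) → GaugeConfig 3 L SU2), q.2.2)
        ∂((configMeasure SU2 L).prod ρ) =
      ∫⁻ q, G ((Fin.cons (recon q.1) q.2.1 : Fin (2 * L - 1 + 1) → GaugeConfig 3 L SU2), q.2.2)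
        ∂((τ.prod ω).prod ρ) := by
    have hm : MeasurePreserving (Prod.map (recon (L := L)) id) ((τ.prod ω).prod ρ) ((configMeasure SU2 L).prod ρ) :=
      measurePreserving_recon.prod (MeasurePreserving.id ρ)
    have key := hm.lintegral_comp
      (f := fun q : GaugeConfig 3 L SU2 × ((Fin (2 * L - 1) → GaugeConfig 3 L SU2) × (Site 3 L → SU2)) =>
        G ((Fin.cons q.1 q.2.1 : Fin (2 * L - 1 + 1) → GaugeConfig 3 L SU2), q.2.2)) (hG.comp hA)
    rw [← key]
    simp only [Prod.map_fst, Prod.map_snd, id_eq]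
  -- step 3: for fixed `(t, w)`, gauge invariance moves the transporter onto the other slices and the seam, where `ρ` is invariant
  have h3 : ∀ q : (TreeIdx L → SU2) × (OffIdx L → SU2),
      ∫⁻ r, G ((Fin.cons (recon q) r.1 : Fin (2 * L - 1 + 1) → GaugeConfig 3 L SU2), r.2) ∂ρ =
        ∫⁻ r, G ((Fin.cons (glue q.2) r.1 : Fin (2 * L - 1 + 1) → GaugeConfig 3 L SU2), r.2) ∂ρ := by
    intro q
    set γ : Site 3 L → SU2 := treeGauge (recon q) with hγ
    have hfix : gaugeTransform γ (recon q) = glue q.2 := by rw [hγ]; exact treeFix_recon q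
    have hpt : ∀ r : (Fin (2 * L - 1) → GaugeConfig 3 L SU2) × (Site 3 L → SU2),
        G ((Fin.cons (recon q) r.1 : Fin (2 * L - 1 + 1) → GaugeConfig 3 L SU2), r.2) =
          G ((Fin.cons (glue q.2) (fun j => gaugeTransform γ (r.1 j)) : Fin (2 * L - 1 + 1) → GaugeConfig 3 L SU2),
            γ * r.2 * γ⁻¹) := by
      intro r
      rw [← hinv γ ((Fin.cons (recon q) r.1 : Fin (2 * L - 1 + 1) → GaugeConfig 3 L SU2), r.2)]
      congr 1
      refine Prod.ext ?_ rfl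
      funext i
      refine Fin.cases ?_ (fun j => ?_) i
      · simp only [Fin.cons_zero, hfix]
      · simp only [Fin.cons_succ]
    have ha : MeasurePreserving (fun Us : Fin (2 * L - 1) → GaugeConfig 3 L SU2 => fun j => gaugeTransform γ (Us j))
        (Measure.pi fun _ : Fin (2 * L - 1) => configMeasure SU2 L)
        (Measure.pi fun _ : Fin (2 * L - 1) => configMeasure SU2 L) :=
      measurePreserving_pi (f := fun (_ : Fin (2 * L - 1)) (U : GaugeConfig 3 L SU2) => gaugeTransform γ U) _ _
        fun _ => Literature.Barriers.QuantumFields.Elitzur.measurePreserving_gaugeTransform γ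
    have hb : MeasurePreserving (fun g : Site 3 L → SU2 => γ * g * γ⁻¹) (gaugeMeasure L) (gaugeMeasure L) :=
      measurePreserving_pi (f := fun (x : Site 3 L) (u : SU2) => γ x * u * (γ x)⁻¹) _ _
        fun x => measurePreserving_mul_mul_inv_haarProbability (γ x) (γ x)
    have hρinv : MeasurePreserving
        (Prod.map (fun Us : Fin (2 * L - 1) → GaugeConfig 3 L SU2 => fun j => gaugeTransform γ (Us j))
          (fun g : Site 3 L → SU2 => γ * g * γ⁻¹)) ρ ρ := ha.prod hb
    have hGw : Measurable fun r : (Fin (2 * L - 1) → GaugeConfig 3 L SU2) × (Site 3 L → SU2) =>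
        G ((Fin.cons (glue q.2) r.1 : Fin (2 * L - 1 + 1) → GaugeConfig 3 L SU2), r.2) :=
      hG.comp (hA.comp (measurable_const.prodMk measurable_id))
    rw [lintegral_congr hpt, ← hρinv.lintegral_comp hGw]
    simp only [Prod.map_fst, Prod.map_snd]
  -- step 4: iterate, rewrite the inner integral, and integrate out the tree links
  have hK : Measurable fun x : ((TreeIdx L → SU2) × (OffIdx L → SU2)) ×
      ((Fin (2 * L - 1) → GaugeConfig 3 L SU2) × (Site 3 L → SU2)) =>
        G ((Fin.cons (recon x.1) x.2.1 : Fin (2 * L - 1 + 1) → GaugeConfig 3 L SU2), x.2.2) :=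
    hG.comp (hA.comp ((measurable_recon.comp measurable_fst).prodMk measurable_snd))
  have hΦ : Measurable fun w : OffIdx L → SU2 =>
      ∫⁻ r, G ((Fin.cons (glue w) r.1 : Fin (2 * L - 1 + 1) → GaugeConfig 3 L SU2), r.2) ∂ρ :=
    Measurable.lintegral_prod_right (f := fun (w : OffIdx L → SU2)
        (r : (Fin (2 * L - 1) → GaugeConfig 3 L SU2) × (Site 3 L → SU2)) =>
          G ((Fin.cons (glue w) r.1 : Fin (2 * L - 1 + 1) → GaugeConfig 3 L SU2), r.2))
      (hG.comp (hA.comp ((measurable_glue.comp measurable_fst).prodMk measurable_snd)))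
  rw [h1, h2, lintegral_prod _ hK.aemeasurable]
  simp only [h3]
  rw [lintegral_prod (fun x : (TreeIdx L → SU2) × (OffIdx L → SU2) =>
      ∫⁻ r, G ((Fin.cons (glue x.2) r.1 : Fin (2 * L - 1 + 1) → GaugeConfig 3 L SU2), r.2) ∂ρ)
    (hΦ.comp measurable_snd).aemeasurable]
  simp only [lintegral_const, measure_univ, mul_one]

/-- ★ **The ring integral of a gauge-invariant functional in tree gauge** (real-valued, `0 ≤ G ≤ C`). [cite: SeilerLNP1982, §2] -/
theorem integral_ringMeasure_eq_treeGauge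
    {G : (Fin (2 * L - 1 + 1) → GaugeConfig 3 L SU2) × (Site 3 L → SU2) → ℝ} (hG : Measurable G)
    (hinv : ∀ (h : Site 3 L → SU2) (p : (Fin (2 * L - 1 + 1) → GaugeConfig 3 L SU2) × (Site 3 L → SU2)),
      G ((fun i => gaugeTransform h (p.1 i)), h * p.2 * h⁻¹) = G p)
    (h0 : ∀ p, 0 ≤ G p) {C : ℝ} (hC : ∀ p, G p ≤ C) :
    ∫ p, G p ∂(ringMeasure L) =
      ∫ w, (∫ r, G ((Fin.cons (glue w) r.1 : Fin (2 * L - 1 + 1) → GaugeConfig 3 L SU2), r.2)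
        ∂((Measure.pi fun _ : Fin (2 * L - 1) => configMeasure SU2 L).prod (gaugeMeasure L)))
        ∂(Measure.pi fun _ : OffIdx L => haarProbability SU2) := by
  haveI : IsProbabilityMeasure (gaugeMeasure L) := by unfold gaugeMeasure; infer_instance
  haveI : IsProbabilityMeasure (ringMeasure L) := by unfold ringMeasure; infer_instance
  set ρ : Measure ((Fin (2 * L - 1) → GaugeConfig 3 L SU2) × (Site 3 L → SU2)) :=
    (Measure.pi fun _ : Fin (2 * L - 1) => configMeasure SU2 L).prod (gaugeMeasure L) with hρ
  have hA := measurable_ringCons (L := L)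
  have hG' : Measurable fun p => ENNReal.ofReal (G p) := ENNReal.measurable_ofReal.comp hG
  have key := lintegral_ringMeasure_eq_treeGauge (L := L) hG' (fun h p => by simp only [hinv h p])
  -- left-hand side as a lintegral
  have hL : ∫ p, G p ∂(ringMeasure L) = (∫⁻ p, ENNReal.ofReal (G p) ∂(ringMeasure L)).toReal :=
    integral_eq_lintegral_of_nonneg_ae (Eventually.of_forall h0) hG.aestronglyMeasurable
  -- inner integrals as lintegrals
  have hin : ∀ w : OffIdx L → SU2,
      ∫ r, G ((Fin.cons (glue w) r.1 : Fin (2 * L - 1 + 1) → GaugeConfig 3 L SU2), r.2) ∂ρ =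
        (∫⁻ r, ENNReal.ofReal (G ((Fin.cons (glue w) r.1 : Fin (2 * L - 1 + 1) → GaugeConfig 3 L SU2), r.2)) ∂ρ).toReal :=
    fun w => integral_eq_lintegral_of_nonneg_ae (Eventually.of_forall fun r => h0 _)
      (hG.comp (hA.comp (measurable_const.prodMk measurable_id))).aestronglyMeasurable
  have hΦ : Measurable fun w : OffIdx L → SU2 =>
      ∫⁻ r, ENNReal.ofReal (G ((Fin.cons (glue w) r.1 : Fin (2 * L - 1 + 1) → GaugeConfig 3 L SU2), r.2)) ∂ρ :=
    Measurable.lintegral_prod_right (f := fun (w : OffIdx L → SU2)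
        (r : (Fin (2 * L - 1) → GaugeConfig 3 L SU2) × (Site 3 L → SU2)) =>
          ENNReal.ofReal (G ((Fin.cons (glue w) r.1 : Fin (2 * L - 1 + 1) → GaugeConfig 3 L SU2), r.2)))
      (hG'.comp (hA.comp ((measurable_glue.comp measurable_fst).prodMk measurable_snd)))
  have hfin : ∀ᵐ w ∂(Measure.pi fun _ : OffIdx L => haarProbability SU2),
      ∫⁻ r, ENNReal.ofReal (G ((Fin.cons (glue w) r.1 : Fin (2 * L - 1 + 1) → GaugeConfig 3 L SU2), r.2)) ∂ρ < ∞ := by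
    refine Eventually.of_forall fun w => ?_
    calc ∫⁻ r, ENNReal.ofReal (G ((Fin.cons (glue w) r.1 : Fin (2 * L - 1 + 1) → GaugeConfig 3 L SU2), r.2)) ∂ρ
        ≤ ∫⁻ _, ENNReal.ofReal C ∂ρ := lintegral_mono fun r => ENNReal.ofReal_le_ofReal (hC _)
      _ < ∞ := by rw [lintegral_const]; exact ENNReal.mul_lt_top ENNReal.ofReal_lt_top (measure_lt_top _ _)
  rw [hL, key]
  simp_rw [hin]
  exact (integral_toReal hΦ.aemeasurable hfin).symm

end Summit.QuantumFields.YangMills.Theorems.VirialFluxGap.RingDeficit
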